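import Mathlib
import Literature.AlgebraicGeometry.Resolution.CobordantBlowupFiltration
import HarnessLib

/-!
# Extended Rees algebras of a closed subscheme: `R[t⁻¹] → R'[t⁻¹]` is surjective with coefficientwise kernel

Topic: `Literature/AlgebraicGeometry/Resolution`. Let `F = (𝒥ₙ)` be a filtration of ideals of `A` with
extended Rees algebra `R[t⁻¹] = ⊕ₙ 𝒥ₙ tⁿ[t⁻¹] ⊆ A[t, t⁻¹]` (`IdealFiltration.extendedRees`,
`CobordantBlowupFiltration.lean`), whose spectrum is Włodarczyk's full cobordant blow-up `B` of `Spec A`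
(arXiv:2203.03090, Def. 2.3.5 / App. Def. 5.1.1), and let `φ : A → A'` be an algebra with a filtration
`F' = (𝒥ₙ')` of `A'` such that `𝒥ₙ A' ⊆ 𝒥ₙ'`, so that `φ` induces `R[t⁻¹] → R'[t⁻¹]`
(`IdealFiltration.extendedReesMap`). This file proves the two halves of "the strict transform of a closed
subscheme `X = V(ker φ)` under the full cobordant blow-up is the full cobordant blow-up of `X` along the
restricted centre" (Włodarczyk 3.3.12: the strict transform `σˢ(I) = {tᵃ f | f ∈ 𝒪_B · I}` is the ideal of
the schematic closure of `X × 𝔾ₘ ⊆ B₋ = Spec A × 𝔾ₘ` in `B`):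

* `extendedReesMap_eq_zero_iff` — an element of `R[t⁻¹]` dies in `R'[t⁻¹]` iff ALL its Laurent
  coefficients lie in `ker φ` (this coefficient condition is the `t⁻¹`-saturation `σˢ(ker φ)` of
  `ker φ · R[t⁻¹]`, `ExtendedReesSaturation.mem_iSup_colon_iff_forall_coeff_mem`; the identification of the
  kernel with `σˢ(ker φ)` as ideals is recorded in `ExtendedReesStrictTransformQuotient.lean`);
* `extendedReesMap_surjective` — for `φ` SURJECTIVE and `𝒥ₙ' = 𝒥ₙ A'` (the restricted filtration of the
  closed subscheme `Spec A' ⊆ Spec A`) the map `R[t⁻¹] → R'[t⁻¹]` is surjective: every admissible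
  coefficient downstairs lifts to an admissible coefficient upstairs;
* `single_coeff_mem_extendedRees` — the Laurent components `xₘ tᵐ` of an element of `R[t⁻¹]` lie in
  `R[t⁻¹]` (the `ℤ`-grading by the `𝔾ₘ`-action of the cobordant blow-up).

Folklore algebra behind Włodarczyk 2022, 3.3.12–3.3.13 and Lemma 4.4.2 ("`𝒪_Y · I` is sent to the strict
transform ideal"); used by route `ResolutionOfSingularities/WeightedInvariant` (stmt-0572, P2: the weighted
resolution process of a closed `X ⊆ Y` is intrinsic to `X` once the centres are given). PROVED, no
definitions, no named facts.
-/

noncomputable section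

open scoped LaurentPolynomial
open LaurentPolynomial

namespace Literature.AlgebraicGeometry.Resolution

universe u v

namespace IdealFiltration

variable {A : Type u} [CommRing A] {A' : Type v} [CommRing A'] [Algebra A A']
variable (F : IdealFiltration A) (F' : IdealFiltration A')

/-! ## The kernel of `R[t⁻¹] → R'[t⁻¹]`, coefficientwise -/

/-- An element of `R[t⁻¹]` dies in `R'[t⁻¹]` iff all its Laurent coefficients die in `A'`. [folklore] -/
theorem extendedReesMap_eq_zero_iff (hle : ∀ n, (F.ideal n).map (algebraMap A A') ≤ F'.ideal n)
    (x : F.extendedRees) :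
    F.extendedReesMap F' hle x = 0 ↔
      ∀ m : ℤ, (x : A[T;T⁻¹]).coeff m ∈ RingHom.ker (algebraMap A A') := by
  rw [← ZeroMemClass.coe_eq_zero, coe_extendedReesMap]
  constructor
  · intro h m
    have hm := congrArg (fun q : A'[T;T⁻¹] => q.coeff m) h
    simp only [AddMonoidAlgebra.coeff_mapRingHom] at hm
    rw [RingHom.mem_ker, hm]
    rfl
  · intro h
    apply LaurentPolynomial.ext
    intro m
    rw [AddMonoidAlgebra.coeff_mapRingHom, RingHom.mem_ker.mp (h m)]
    rfl

/-! ## Surjectivity for a closed subscheme -/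

/-- **`R[t⁻¹] → R'[t⁻¹]` is surjective** when `φ : A → A'` is surjective and `𝒥ₙ' = 𝒥ₙ A'`: every admissible
coefficient of `R'[t⁻¹]` lifts to an admissible coefficient of `R[t⁻¹]`. [folklore] -/
theorem extendedReesMap_surjective (hsurj : Function.Surjective (algebraMap A A'))
    (heq : ∀ n, F'.ideal n = (F.ideal n).map (algebraMap A A')) :
    Function.Surjective (F.extendedReesMap F' fun n => (heq n).ge) := by
  set φ := algebraMap A A' with hφ
  -- every admissible coefficient downstairs lifts to an admissible coefficient upstairs
  have hlift : ∀ (m : ℤ) (c : A'), F'.CoeffMem m c → ∃ a : A, F.CoeffMem m a ∧ φ a = c := by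
    intro m c hc
    rcases lt_or_ge m 0 with hm | hm
    · obtain ⟨a, rfl⟩ := hsurj c
      exact ⟨a, coeffMem_of_neg hm a, rfl⟩
    · obtain ⟨n, rfl⟩ := Int.eq_ofNat_of_zero_le hm
      have hc' : c ∈ (F.ideal n).map φ := by
        rw [← heq n]
        exact coeffMem_natCast_iff.mp hc
      obtain ⟨a, ha, rfl⟩ := (Ideal.mem_map_iff_of_surjective φ hsurj).mp hc'
      exact ⟨a, coeffMem_natCast_iff.mpr ha, rfl⟩
  intro z
  -- decompose `z` along its (finite) support and lift termwise
  have key : ∀ s : Finset ℤ, (∀ m ∈ s, F'.CoeffMem m ((z : A'[T;T⁻¹]).coeff m)) →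
      ∃ a : A[T;T⁻¹], a ∈ F.extendedRees ∧
        AddMonoidAlgebra.mapRingHom ℤ φ a =
          ∑ m ∈ s, AddMonoidAlgebra.single m ((z : A'[T;T⁻¹]).coeff m) := by
    classical
    intro s
    induction s using Finset.induction_on with
    | empty =>
      intro _
      exact ⟨0, Subalgebra.zero_mem _, by simp⟩
    | insert m s hm ih =>
      intro hs
      obtain ⟨a₁, ha₁, h₁⟩ := ih fun m' hm' => hs m' (Finset.mem_insert_of_mem hm')
      obtain ⟨a, ha, hφa⟩ := hlift m _ (hs m (Finset.mem_insert_self m s))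
      refine ⟨AddMonoidAlgebra.single m a + a₁,
        Subalgebra.add_mem _ ((F.single_mem_extendedRees_iff).mpr ha) ha₁, ?_⟩
      rw [map_add, AddMonoidAlgebra.mapRingHom_single, hφa, h₁, Finset.sum_insert hm]
  obtain ⟨a, ha, h⟩ := key (z : A'[T;T⁻¹]).coeff.support fun m _ => z.2 m
  refine ⟨⟨a, ha⟩, Subtype.ext ?_⟩
  rw [coe_extendedReesMap]
  change AddMonoidAlgebra.mapRingHom ℤ φ a = (z : A'[T;T⁻¹])
  rw [h]
  conv_rhs => rw [← AddMonoidAlgebra.sum_coeff_single (z : A'[T;T⁻¹])]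
  rfl

/-! ## Laurent components -/

/-- The degree-`m` Laurent component `xₘ tᵐ` of an element of `R[t⁻¹]`, as an element of `R[t⁻¹]`.
[folklore] -/
theorem single_coeff_mem_extendedRees (x : F.extendedRees) (m : ℤ) :
    AddMonoidAlgebra.single m ((x : A[T;T⁻¹]).coeff m) ∈ F.extendedRees :=
  (F.single_mem_extendedRees_iff).mpr (x.2 m)

end IdealFiltration

end Literature.AlgebraicGeometry.Resolution

end
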